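import Literature.MathematicalPhysics.QuantumLattice.HubbardTorus2DEnergyDensityConvex
import Literature.MathematicalPhysics.QuantumLattice.DWaveSource
import Literature.MathematicalPhysics.QuantumLattice.HubbardModelGrandCanonicalProofs
import Literature.MathematicalPhysics.QuantumLattice.HubbardGrandCanonicalDensity
import Literature.MathematicalPhysics.QuantumLattice.HubbardRingPerronFrobeniusProofs
import Summits.HubbardSuperconductivity.HubbardSuperconductivity.Theorems.ThermalWedgeTwPureThermalBoundGseeMaster

/-!
# Stub `stub_energyMatchingOfDensityMatching` (D3b) of line `birth`
# (crux `BridgeNodalToDWave`, item stmt-HubbardSuperconductivity-10395, route NodalDiracTwist)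

**Density matching ⇒ energy matching** (`T = 0` equivalence of ensembles, Legendre duality).
Notation: torus `(ℤ/Lℤ)²`, `H_L = hubbardTorus 2 L 1 U`, `K_L(μ) = hubbardTorusWith 2 L 1 U μ = H_L − μN`,
`E_L(N) = groundEnergyAt (fermionTorusGraph 2 L) 1 U N`, `G_L(μ) = E₀(K_L(μ)) = min_N (E_L(N) − μN)`,
`ω_{L,μ} = ` the tracial ground-state functional of `K_L(μ)`, `N_L = 2⌊(1−δ)L²/2⌋`,
`e = energyDensity2D 1 U` (the convex limiting canonical energy density on `[0,2)`).

**Statement.** For `U > 0`, `δ ∈ [1/10, 3/10]`, `μ ∈ ℝ`: if `Re ω_{L,μ}(N)/L² → 1 − δ` (DM), then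
`(minEnergyOn H_L (szSector N_L 0) − μ N_L − G_L(μ)) / L² → 0` (EM) (along the sides `L + 1`).

**Proof outline.**
1. `gcMinimizer_stable`: the GC minimising sectors are stable under small changes of `μ` (finitely
   many sectors: a non-minimiser at `μ` stays a non-minimiser at `μ'` for `|μ' − μ| · 2L² <` gap).
2. `exists_gcMinimizers_bracket`: with the Griffiths sandwich
   `(G_L(μ−h) − G_L(μ))/h ≤ Re ω_{L,μ}(N) ≤ (G_L(μ) − G_L(μ+h))/h` (`gcNumber_torus_mem_Icc_slope`) and
   minimisers `a`, `b` at `μ ∓ h` (which are minimisers at `μ` for small `h`), `a ≤ Re ω_{L,μ}(N) ≤ b`.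
3. `subgradient_of_densityMatching`: (DM) forces `μ` to be a subgradient of `e` at `n₀ = 1 − δ`:
   with ANY subgradient `s` at `n₀` the supporting-line bound `master_lb` gives
   `E_L(N) ≥ L² e(n₀) + s(N − n₀L²) − ηL²` for all `N`; evaluated at `b` (if `s ≥ μ`) or at `a`
   (if `s ≤ μ`), whose densities are `≥ n₀ − η`, `≤ n₀ + η` by (DM), this yields
   `G_L(μ) ≥ L²(e(n₀) − μn₀) − O(η)L²`, while `G_L(μ) ≤ E_L(N_L(y)) − μN_L(y) → L²(e(y) − μy)`.
4. `energyMatching_of_subgradient`: for a subgradient `μ` at `n₀`, `master_lb`/`master_ub`,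
   `G_L = min_N (E_L(N) − μN)` and `SU(2)` (`groundEnergyAt_eq_minEnergyOn_szSector`: the
   `(N_L, S^z = 0)` energy is `E_L(N_L)`) give `|E_L(N_L) − μN_L − G_L(μ)| ≤ εL²` eventually
   (adapted from `CwSsbToEvenTorusLRO.csp_supportingPotential_of_energyDensity`).

Sources: D. Ruelle, *Statistical Mechanics: Rigorous Results* (1969), §3.4 (equivalence of
ensembles / Legendre duality of the convex energy density); R. B. Griffiths, J. Math. Phys. 5 (1964)
1215 (supergradient sandwich); E. H. Lieb, PRL 62 (1989) 1201 (spin sectors, `S^z = 0` costs nothing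
for even `N`). No definition is introduced; everything is proved. playbook: none in payload.
-/

-- the mandated namespace repeats `HubbardSuperconductivity` (single-problem summit, D-0017),
-- which the `dupNamespace` linter flags on every declaration
set_option linter.dupNamespace false

namespace Summit.HubbardSuperconductivity.HubbardSuperconductivity.Theorems.NodalDiracTwist.BridgeNodalToDWave

open Filter Matrix Literature.MathematicalPhysics.QuantumLattice Literature.Probability.LatticeModels
open Literature.MathematicalPhysics.QuantumLattice.ThermodynamicLimit
open Summit.HubbardSuperconductivity.HubbardSuperconductivity.Theorems.TwPureThermalBoundGsee
open scoped Topology ComplexOrder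

/-- **Stability of the grand-canonical minimising sectors in `μ`.** For the torus of side `L` there
is `h₀ > 0` such that for `|μ' − μ| < h₀` every minimising sector of `N ↦ E_L(N) − μ'N` is a
minimising sector of `N ↦ E_L(N) − μN` (finitely many sectors; the gap of the non-minimisers at `μ`
beats `|μ' − μ| · 2L²`). Ruelle (1969) §3.4. [folklore] -/
theorem gcMinimizer_stable (L : ℕ) (U μ : ℝ) :
    ∃ h₀ : ℝ, 0 < h₀ ∧ ∀ μ' : ℝ, |μ' - μ| < h₀ → ∀ N : ℕ, N ≤ 2 * (L * L) →
      (hubbardTorusWith 2 L 1 U μ').groundEnergy =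
          groundEnergyAt (fermionTorusGraph 2 L) 1 U N - μ' * N →
        (hubbardTorusWith 2 L 1 U μ).groundEnergy =
          groundEnergyAt (fermionTorusGraph 2 L) 1 U N - μ * N := by
  classical
  -- the non-minimising sectors at `μ`
  obtain ⟨T, hT⟩ : ∃ T : Finset ℕ, T = (Finset.range (2 * (L * L) + 1)).filter fun N =>
      (hubbardTorusWith 2 L 1 U μ).groundEnergy <
        groundEnergyAt (fermionTorusGraph 2 L) 1 U N - μ * N := ⟨_, rfl⟩
  have hmemT : ∀ N : ℕ, N ≤ 2 * (L * L) →
      (hubbardTorusWith 2 L 1 U μ).groundEnergy <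
        groundEnergyAt (fermionTorusGraph 2 L) 1 U N - μ * N → N ∈ T := by
    intro N hN hlt
    rw [hT, Finset.mem_filter, Finset.mem_range]
    exact ⟨by omega, hlt⟩
  rcases T.eq_empty_or_nonempty with hTe | hTne
  · -- every sector minimises
    refine ⟨1, one_pos, fun μ' _ N hN _ => ?_⟩
    have hle := gc_le_sector L U μ hN
    rcases hle.lt_or_eq with hlt | heq
    · have hmem := hmemT N hN hlt
      rw [hTe] at hmem
      exact absurd hmem (Finset.notMem_empty N)
    · exact heq
  · -- the gap of the non-minimisers
    obtain ⟨γ, hγ⟩ : ∃ γ : ℝ, γ = T.inf' hTne fun N =>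
        groundEnergyAt (fermionTorusGraph 2 L) 1 U N - μ * N -
          (hubbardTorusWith 2 L 1 U μ).groundEnergy := ⟨_, rfl⟩
    have hγpos : 0 < γ := by
      rw [hγ, Finset.lt_inf'_iff]
      intro N hN
      rw [hT, Finset.mem_filter] at hN
      linarith [hN.2]
    have hγle : ∀ N ∈ T, γ ≤ groundEnergyAt (fermionTorusGraph 2 L) 1 U N - μ * N -
        (hubbardTorusWith 2 L 1 U μ).groundEnergy := by
      intro N hN
      rw [hγ]
      exact Finset.inf'_le _ hN
    have hden : (0 : ℝ) < 2 * ((L : ℝ) * L) + 1 := by positivity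
    refine ⟨γ / (2 * ((L : ℝ) * L) + 1), div_pos hγpos hden, fun μ' hμ' N hN hmin => ?_⟩
    obtain ⟨Ns, hNs, hgs⟩ := exists_gcSector L U μ
    have hmin' := gc_le_sector L U μ' hNs
    have hle := gc_le_sector L U μ hN
    rcases hle.lt_or_eq with hlt | heq
    · exfalso
      have h1 := hγle N (hmemT N hN hlt)
      -- minimality at `μ'` against the minimiser `Ns` at `μ`
      have h2 : groundEnergyAt (fermionTorusGraph 2 L) 1 U N - μ * N -
          (hubbardTorusWith 2 L 1 U μ).groundEnergy ≤ (μ' - μ) * ((N : ℝ) - Ns) := by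
        rw [hgs]
        rw [hmin] at hmin'
        linarith
      have hNr : (N : ℝ) ≤ 2 * ((L : ℝ) * L) := by exact_mod_cast hN
      have hNsr : (Ns : ℝ) ≤ 2 * ((L : ℝ) * L) := by exact_mod_cast hNs
      have hN0 : (0 : ℝ) ≤ N := Nat.cast_nonneg N
      have hNs0 : (0 : ℝ) ≤ Ns := Nat.cast_nonneg Ns
      have h3 : (μ' - μ) * ((N : ℝ) - Ns) ≤ |μ' - μ| * (2 * ((L : ℝ) * L)) :=
        calc (μ' - μ) * ((N : ℝ) - Ns) ≤ |(μ' - μ) * ((N : ℝ) - Ns)| := le_abs_self _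
          _ = |μ' - μ| * |(N : ℝ) - Ns| := abs_mul _ _
          _ ≤ |μ' - μ| * (2 * ((L : ℝ) * L)) :=
              mul_le_mul_of_nonneg_left (abs_le.2 ⟨by linarith, by linarith⟩) (abs_nonneg _)
      have h4 : |μ' - μ| * (2 * ((L : ℝ) * L)) < γ := by
        have h5 := mul_lt_mul_of_pos_right hμ' hden
        rw [div_mul_cancel₀ _ hden.ne'] at h5
        have h6 : |μ' - μ| * (2 * ((L : ℝ) * L)) ≤ |μ' - μ| * (2 * ((L : ℝ) * L) + 1) :=
          mul_le_mul_of_nonneg_left (by linarith) (abs_nonneg _)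
        linarith
      linarith
    · exact heq

/-- **The tracial ground-state density is bracketed by two minimising sectors.** For the torus of
side `L` there are grand-canonical minimising sectors `a, b` at `μ` (`E_L(a) − μa = E_L(b) − μb =
G_L(μ)`) with `a ≤ Re ω_{L,μ}(N) ≤ b`: the Griffiths sandwich `gcNumber_torus_mem_Icc_slope` at a step
`h` so small that the minimisers at `μ ∓ h` are minimisers at `μ` (`gcMinimizer_stable`), where the
secant slopes ARE those particle numbers. Griffiths (1964); Ruelle (1969) §3.4. [folklore] -/
theorem exists_gcMinimizers_bracket (L : ℕ) (U μ : ℝ) :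
    ∃ a b : ℕ, a ≤ 2 * (L * L) ∧ b ≤ 2 * (L * L) ∧
      (hubbardTorusWith 2 L 1 U μ).groundEnergy = groundEnergyAt (fermionTorusGraph 2 L) 1 U a - μ * a ∧
      (hubbardTorusWith 2 L 1 U μ).groundEnergy = groundEnergyAt (fermionTorusGraph 2 L) 1 U b - μ * b ∧
      (a : ℝ) ≤ ((hubbardTorusWith 2 L 1 U μ).groundStateFunctional totalNumber).re ∧
      ((hubbardTorusWith 2 L 1 U μ).groundStateFunctional totalNumber).re ≤ b := by
  obtain ⟨h₀, hh₀, hstab⟩ := gcMinimizer_stable L U μ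
  have hh : 0 < h₀ / 2 := half_pos hh₀
  obtain ⟨a, ha, hga⟩ := exists_gcSector L U (μ - h₀ / 2)
  obtain ⟨b, hb, hgb⟩ := exists_gcSector L U (μ + h₀ / 2)
  have hga' := hstab (μ - h₀ / 2)
    (by rw [sub_sub_cancel_left, abs_neg, abs_of_pos hh]; linarith) a ha hga
  have hgb' := hstab (μ + h₀ / 2)
    (by rw [add_sub_cancel_left, abs_of_pos hh]; linarith) b hb hgb
  obtain ⟨hlo, hhi⟩ := gcNumber_torus_mem_Icc_slope L 1 U μ hh
  refine ⟨a, b, ha, hb, hga', hgb', ?_, ?_⟩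
  · have hq : ((hubbardTorusWith 2 L 1 U (μ - h₀ / 2)).groundEnergy -
        (hubbardTorusWith 2 L 1 U μ).groundEnergy) / (h₀ / 2) = a := by
      rw [hga, hga']
      field_simp
      ring
    rw [hq] at hlo
    exact hlo
  · have hq : ((hubbardTorusWith 2 L 1 U μ).groundEnergy -
        (hubbardTorusWith 2 L 1 U (μ + h₀ / 2)).groundEnergy) / (h₀ / 2) = b := by
      rw [hgb, hgb']
      field_simp
      ring
    rw [hq] at hhi
    exact hhi

/-- **Density matching forces the chemical potential to be a subgradient.** If `U ≥ 0`,
`0 < n₀ < 2` and the tracial ground-state density of `K_{L+1}(μ)` tends to `n₀`, then `μ` is a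
subgradient at `n₀` of the convex limiting energy density `e = energyDensity2D 1 U` on `[0, 2)`:
`e(n₀) + μ(y − n₀) ≤ e(y)`. (With ANY subgradient `s` at `n₀`, the supporting line `master_lb`
evaluated at the bracketing minimiser `b` (if `s ≥ μ`) or `a` (if `s ≤ μ`) of
`exists_gcMinimizers_bracket`, whose density is pinned near `n₀` by (DM), bounds `G_L(μ)` below by
`L²(e(n₀) − μn₀) − O(η)L²`; the competitor `N_L(y)` bounds it above by `L²(e(y) − μy) + o(L²)`.)
Ruelle (1969) §3.4. [cite: Ruelle1969, §3.4] -/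
theorem subgradient_of_densityMatching {U : ℝ} (hU : 0 ≤ U) {n₀ : ℝ} (hn0 : 0 < n₀) (hn2 : n₀ < 2)
    (μ : ℝ)
    (hDM : Tendsto (fun L : ℕ => ((hubbardTorusWith 2 (L + 1) 1 U μ).groundStateFunctional
      totalNumber).re / ((L + 1 : ℕ) : ℝ) ^ 2) atTop (𝓝 n₀)) :
    ∀ y ∈ Set.Ico (0 : ℝ) 2, energyDensity2D 1 U n₀ + μ * (y - n₀) ≤ energyDensity2D 1 U y := by
  obtain ⟨s, hs⟩ := exists_subgradient_of_convexOn_Ico (convexOn_energyDensity2D 1 hU) ⟨hn0, hn2⟩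
  rintro y ⟨hy0, hy2⟩
  have hC : 0 < |s - μ| + 3 := by positivity
  -- it suffices to prove the inequality up to `(|s - μ| + 3) η` for every `η > 0`
  suffices key : ∀ η : ℝ, 0 < η →
      energyDensity2D 1 U n₀ - μ * n₀ ≤ energyDensity2D 1 U y - μ * y + (|s - μ| + 3) * η by
    have h : energyDensity2D 1 U n₀ - μ * n₀ ≤ energyDensity2D 1 U y - μ * y := by
      refine le_of_forall_pos_le_add fun ε hε => ?_
      have := key (ε / (|s - μ| + 3)) (div_pos hε hC)
      rwa [mul_div_cancel₀ _ hC.ne'] at this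
    linarith
  intro η hη
  obtain ⟨L₁, hL₁⟩ := master_lb hU hs hη
  obtain ⟨L₂, hL₂⟩ := master_ub hU hy0 hy2 hη
  obtain ⟨L₃, hL₃⟩ := Metric.tendsto_atTop.1 hDM η hη
  obtain ⟨L₄, hL₄⟩ := exists_nat_gt (2 * |μ| / η)
  -- a common large side `M = L' + 1`
  obtain ⟨L', h1, h2, h3, h4⟩ : ∃ L' : ℕ, L₁ ≤ L' ∧ L₂ ≤ L' ∧ L₃ ≤ L' ∧ L₄ ≤ L' :=
    ⟨L₁ + L₂ + L₃ + L₄, by omega, by omega, by omega, by omega⟩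
  have hD := hL₃ L' h3
  rw [Real.dist_eq, abs_sub_lt_iff] at hD
  obtain ⟨hD1, hD2⟩ := hD
  set M : ℕ := L' + 1 with hM
  have hMpos : (0 : ℝ) < M := by positivity
  have hM2 : (0 : ℝ) < (M : ℝ) ^ 2 := by positivity
  have hM1 : (1 : ℝ) ≤ M := by exact_mod_cast (show 1 ≤ M by omega)
  have hM₁ : L₁ ≤ M := by omega
  have hM₂ : L₂ ≤ M := by omega
  have hM₄ : 2 * |μ| / η < M := hL₄.trans_le (by exact_mod_cast (show L₄ ≤ M by omega))
  -- the tracial density is within `η` of `n₀`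
  have hω1 : ((hubbardTorusWith 2 M 1 U μ).groundStateFunctional totalNumber).re <
      (n₀ + η) * (M : ℝ) ^ 2 := by
    rw [sub_lt_iff_lt_add, div_lt_iff₀ hM2] at hD1
    linarith
  have hω2 : (n₀ - η) * (M : ℝ) ^ 2 <
      ((hubbardTorusWith 2 M 1 U μ).groundStateFunctional totalNumber).re := by
    rw [sub_lt_comm, lt_div_iff₀ hM2] at hD2
    exact hD2
  -- bracketing minimisers and the supporting line at them
  obtain ⟨a, b, ha, hb, hga, hgb, haω, hωb⟩ := exists_gcMinimizers_bracket M U μ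
  have hla := hL₁ M hM₁ a ha
  have hlb := hL₁ M hM₁ b hb
  -- the competitor at density `y`
  have hNy : rectN y M ≤ 2 * (M * M) := rectN_le_two_mul hy0 hy2.le M
  have hgc := gc_le_sector M U μ hNy
  have huy := hL₂ M hM₂
  have h5 : μ * (y * (M : ℝ) ^ 2 - rectN y M) ≤ 2 * |μ| := by
    have h3' := rectN_le hy0 M
    have h4' := lt_rectN_add_two y M
    calc μ * (y * (M : ℝ) ^ 2 - rectN y M) ≤ |μ * (y * (M : ℝ) ^ 2 - rectN y M)| := le_abs_self _
      _ = |μ| * |y * (M : ℝ) ^ 2 - rectN y M| := abs_mul _ _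
      _ ≤ |μ| * 2 := mul_le_mul_of_nonneg_left (abs_le.2 ⟨by linarith, by linarith⟩) (abs_nonneg μ)
      _ = 2 * |μ| := by ring
  have h6 : 2 * |μ| ≤ η * (M : ℝ) ^ 2 := by
    rw [div_lt_iff₀ hη] at hM₄
    nlinarith [abs_nonneg μ]
  -- upper bound on `G_M(μ)`
  have hup : (hubbardTorusWith 2 M 1 U μ).groundEnergy ≤
      (M : ℝ) ^ 2 * (energyDensity2D 1 U y - μ * y) + η * (M : ℝ) ^ 2 + 2 * |μ| := by
    linarith [hgc, huy, h5]
  -- lower bound on `G_M(μ)`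
  have hlow : (M : ℝ) ^ 2 * (energyDensity2D 1 U n₀ - μ * n₀) - (|s - μ| + 1) * η * (M : ℝ) ^ 2 ≤
      (hubbardTorusWith 2 M 1 U μ).groundEnergy := by
    rcases le_total μ s with hμs | hsμ
    · rw [abs_of_nonneg (sub_nonneg.2 hμs), hgb]
      have hX : 0 ≤ ((b : ℝ) - n₀ * (M : ℝ) ^ 2) + η * (M : ℝ) ^ 2 := by linarith
      have hprod : 0 ≤ (s - μ) * (((b : ℝ) - n₀ * (M : ℝ) ^ 2) + η * (M : ℝ) ^ 2) :=
        mul_nonneg (sub_nonneg.2 hμs) hX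
      linarith [hlb, hprod]
    · rw [abs_of_nonpos (sub_nonpos.2 hsμ), hga]
      have hX : 0 ≤ η * (M : ℝ) ^ 2 - ((a : ℝ) - n₀ * (M : ℝ) ^ 2) := by linarith
      have hprod : 0 ≤ (μ - s) * (η * (M : ℝ) ^ 2 - ((a : ℝ) - n₀ * (M : ℝ) ^ 2)) :=
        mul_nonneg (sub_nonneg.2 hsμ) hX
      linarith [hla, hprod]
  -- combine and divide by `M²`
  have hfin : (M : ℝ) ^ 2 * (energyDensity2D 1 U n₀ - μ * n₀) ≤
      (M : ℝ) ^ 2 * (energyDensity2D 1 U y - μ * y + (|s - μ| + 3) * η) := by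
    have hsμ0 : 0 ≤ |s - μ| := abs_nonneg _
    nlinarith [hlow, hup, h6, mul_nonneg hsμ0 (mul_nonneg hη.le hM2.le)]
  exact le_of_mul_le_mul_left hfin hM2

/-- **Energy matching at a subgradient** (`T = 0` equivalence of ensembles, Ruelle (1969) §3.4).
If `U ≥ 0`, `0 < 1 − δ < 2` and `μ` is a subgradient at `1 − δ` of `energyDensity2D 1 U` on `[0,2)`,
then for every `ε > 0`, eventually in the side `L`,
`|minEnergyOn H_L (szSector N_L 0) − μN_L − E₀(H_L − μN)| ≤ εL²`, `N_L = 2⌊(1−δ)L²/2⌋`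
(master bounds `master_ub`/`master_lb`, `E₀(H − μN) = min_N (E(N) − μN)`, and `SU(2)`:
`groundEnergyAt_eq_minEnergyOn_szSector`). [cite: Ruelle1969, §3.4] -/
-- adapted from `CwSsbToEvenTorusLRO.csp_supportingPotential_of_energyDensity`
-- (Theorems/ChiralWindowCwSsbToEvenTorusLROCanonicalSupportingPotential.lean)
theorem energyMatching_of_subgradient {U : ℝ} (hU : 0 ≤ U) {δ : ℝ} (hn0 : 0 < 1 - δ)
    (hn2 : 1 - δ < 2) {μ : ℝ}
    (hs : ∀ y ∈ Set.Ico (0 : ℝ) 2,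
      energyDensity2D 1 U (1 - δ) + μ * (y - (1 - δ)) ≤ energyDensity2D 1 U y) :
    ∀ ε : ℝ, 0 < ε → ∃ L₀ : ℕ, ∀ L : ℕ, L₀ ≤ L →
      |(hubbardTorus 2 L 1 U).minEnergyOn (szSector (2 * ⌊(1 - δ) * (L : ℝ) ^ 2 / 2⌋₊) 0) -
          μ * ((2 * ⌊(1 - δ) * (L : ℝ) ^ 2 / 2⌋₊ : ℕ) : ℝ) -
          (hubbardTorusWith 2 L 1 U μ).groundEnergy| ≤ ε * (L : ℝ) ^ 2 := by
  intro ε hε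
  have hη : 0 < ε / 4 := by positivity
  obtain ⟨L₁, hL₁⟩ := master_lb hU hs hη
  obtain ⟨L₂, hL₂⟩ := master_ub hU hn0.le hn2 hη
  obtain ⟨L₃, hL₃⟩ := exists_nat_gt (4 * |μ| / ε)
  refine ⟨max (max L₁ L₂) (max L₃ 1), fun L hL => ?_⟩
  have hLL₁ : L₁ ≤ L := (le_max_left _ _).trans ((le_max_left _ _).trans hL)
  have hLL₂ : L₂ ≤ L := (le_max_right _ _).trans ((le_max_left _ _).trans hL)
  have hLL₃ : L₃ ≤ L := (le_max_left _ _).trans ((le_max_right _ _).trans hL)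
  have hL1 : 1 ≤ L := (le_max_right _ _).trans ((le_max_right _ _).trans hL)
  have hL1r : (1 : ℝ) ≤ L := by exact_mod_cast hL1
  -- the `(N_L, S^z = 0)` sector energy is the `N_L`-sector energy (`SU(2)`)
  have hNL : 2 * ⌊(1 - δ) * (L : ℝ) ^ 2 / 2⌋₊ = rectN (1 - δ) L := rfl
  have hNle : rectN (1 - δ) L ≤ 2 * (L * L) := rectN_le_two_mul hn0.le hn2.le L
  have hhalf : ⌊(1 - δ) * (L : ℝ) ^ 2 / 2⌋₊ ≤ Fintype.card (FermionTorus 2 L) := by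
    rw [card_fermionTorus_two']
    rw [← hNL] at hNle; omega
  have hSU2 := groundEnergyAt_eq_minEnergyOn_szSector (fermionTorusGraph 2 L) 1 U hhalf
  rw [show hubbardTorus 2 L 1 U = hamiltonian (fermionTorusGraph 2 L) 1 U from rfl, ← hSU2, hNL]
  -- the grand-canonical ground energy is attained in a sector `N°` and lies below every sector
  obtain ⟨N₀, hN₀, hgc⟩ := exists_gcSector L U μ
  have hlow := gc_le_sector L U μ hNle
  -- master bounds
  have h1 := hL₁ L hLL₁ N₀ hN₀
  have h2 := hL₂ L hLL₂
  have h3 := rectN_le hn0.le L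
  have h4 := lt_rectN_add_two (1 - δ) L
  have hslack : 2 * |μ| ≤ ε / 2 * (L : ℝ) ^ 2 := by
    have : 4 * |μ| / ε < L := hL₃.trans_le (by exact_mod_cast hLL₃)
    rw [div_lt_iff₀ hε] at this
    nlinarith [abs_nonneg μ]
  have h5 : μ * ((1 - δ) * (L : ℝ) ^ 2 - rectN (1 - δ) L) ≤ 2 * |μ| := by
    calc μ * ((1 - δ) * (L : ℝ) ^ 2 - rectN (1 - δ) L)
        ≤ |μ * ((1 - δ) * (L : ℝ) ^ 2 - rectN (1 - δ) L)| := le_abs_self _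
      _ = |μ| * |(1 - δ) * (L : ℝ) ^ 2 - rectN (1 - δ) L| := abs_mul _ _
      _ ≤ |μ| * 2 := mul_le_mul_of_nonneg_left (abs_le.2 ⟨by linarith, by linarith⟩) (abs_nonneg μ)
      _ = 2 * |μ| := by ring
  rw [abs_le]
  constructor
  · nlinarith [hlow, hε]
  · rw [hgc]
    nlinarith [h1, h2, h5, hslack]

/-- **Stub D3b — density matching ⇒ energy matching** (registered stub
`stub_energyMatchingOfDensityMatching` of line `birth`, crux `BridgeNodalToDWave`). For `U > 0`,
`δ ∈ [1/10, 3/10]` and real `μ`: if the tracial grand-canonical ground-state density of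
`hubbardTorusWith 2 (L+1) 1 U μ` tends to `1 − δ`, then the `(N_L, S^z = 0)`-sector ground energy of
`hubbardTorus 2 (L+1) 1 U` realises the grand-canonical ground energy at `μ` up to `o(L²)`:
`(minEnergyOn − μN_L − E₀(H − μN))/(L+1)² → 0`. Density matching makes `μ` a subgradient of the
convex limiting energy density at `1 − δ` (`subgradient_of_densityMatching`), and at a subgradient
the two ensembles match (`energyMatching_of_subgradient`). Ruelle (1969) §3.4; Lieb (1989).
[cite: Ruelle1969, §3.4] -/
theorem stub_energyMatchingOfDensityMatching : ∀ (U δ μ : ℝ), 0 < U → δ ∈ Set.Icc (1 / 10 : ℝ) (3 / 10) →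
    Filter.Tendsto (fun L : ℕ =>
      ((Literature.MathematicalPhysics.QuantumLattice.hubbardTorusWith 2 (L + 1) 1 U μ).groundStateFunctional
        Literature.MathematicalPhysics.QuantumLattice.totalNumber).re / ((L + 1 : ℕ) : ℝ) ^ 2)
      Filter.atTop (nhds (1 - δ)) →
    Filter.Tendsto (fun L : ℕ =>
      ((Literature.MathematicalPhysics.QuantumLattice.hubbardTorus 2 (L + 1) 1 U).minEnergyOn
          (Literature.MathematicalPhysics.QuantumLattice.szSector
            (2 * ⌊(1 - δ) * ((L + 1 : ℕ) : ℝ) ^ 2 / 2⌋₊) 0) -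
        μ * ((2 * ⌊(1 - δ) * ((L + 1 : ℕ) : ℝ) ^ 2 / 2⌋₊ : ℕ) : ℝ) -
        (Literature.MathematicalPhysics.QuantumLattice.hubbardTorusWith 2 (L + 1) 1 U μ).groundEnergy) /
        ((L + 1 : ℕ) : ℝ) ^ 2) Filter.atTop (nhds 0) := by
  intro U δ μ hU hδ hDM
  obtain ⟨hδ1, hδ2⟩ := hδ
  have hn0 : (0 : ℝ) < 1 - δ := by linarith
  have hn2 : (1 : ℝ) - δ < 2 := by linarith
  have hs := subgradient_of_densityMatching hU.le hn0 hn2 μ hDM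
  have hEM := energyMatching_of_subgradient hU.le hn0 hn2 hs
  rw [Metric.tendsto_atTop]
  intro ε hε
  obtain ⟨L₀, hL₀⟩ := hEM (ε / 2) (half_pos hε)
  refine ⟨L₀, fun L hL => ?_⟩
  have h := hL₀ (L + 1) (by omega)
  have hpos : (0 : ℝ) < ((L + 1 : ℕ) : ℝ) ^ 2 := by positivity
  rw [Real.dist_eq, sub_zero, abs_div, abs_of_pos hpos, div_lt_iff₀ hpos]
  have hpos' : (0 : ℝ) < ε / 2 * ((L + 1 : ℕ) : ℝ) ^ 2 := by positivity
  linarith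

end Summit.HubbardSuperconductivity.HubbardSuperconductivity.Theorems.NodalDiracTwist.BridgeNodalToDWave
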